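import Summits.PneNP.PneNP.Theorems.KarlinRubinMonotoneBlindFormDefs
import Literature.Computability.Complexity.CircuitLowerBoundsHastadProofs
import Literature.Computability.Complexity.RossmanMonotoneClique

/-!
# Route KarlinRubin, crux `MonotoneBlind` (stmt-PneNP-18027): constant depth — unfolding a monotone AC⁰ circuit

Stage C of the AC⁰ line (seat write-up `MonotoneBlind_AC0_theorem.md`): the bridge from the library's straight-line
circuits over `monotoneACBasis = {∧ₘ, ∨ₘ | m}` (`Circuit`, `IsOver`, `size`, `acDepth`) to the layered formulas `swForm`
of `…FormDefs`, so that `karlinRubin_monotoneBlind_constDepth'` can be stated for circuits (`…FormCircuit`).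

* `swUnfold gs ℓ pol w` — the level-`ℓ` layered formula, with top polarity `pol`, of the wire `w` of the gate list `gs`:
  an input slot `e` becomes a chain of one-child gates down to the leaf `{e}`; a gate of the required polarity becomes
  the node of its (deduplicated) argument wires one level down; a gate of the other polarity is wrapped in a
  one-child node. Two levels per unit of `acDepth` suffice (`…FormCircuit`).

All `--supports stmt-PneNP-18027`. One definition.
-/

set_option linter.dupNamespace false -- `Summit.PneNP.PneNP.…`: summit = sub-problem (D-0017)

namespace Summit.PneNP.PneNP.Theorems

open Finset
open Literature.Computability.Complexity
open Literature.Probability.RandomGraphs.PlantedClique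

variable {n : ℕ}

open Classical in
/-- **Unfolding a wire of a monotone unbounded fan-in straight-line program into a layered formula** of level `ℓ`
and top polarity `pol` (`true` = OR): see the module docstring. Out-of-range gate wires and gate wires at level `0`
are junk (empty gates). [folklore] -/
noncomputable def swUnfold (gs : List (Gate (⊤ : SimpleGraph (Fin n)).edgeSet)) :
    (ℓ : ℕ) → Bool → ((⊤ : SimpleGraph (Fin n)).edgeSet ⊕ ℕ) → swForm n ℓ
  | 0, _, .inl e => swForm.leaf {e}
  | 0, _, .inr _ => swForm.leaf ∅
  | ℓ + 1, pol, .inl e => swForm.node [swUnfold gs ℓ (!pol) (.inl e)]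
  | ℓ + 1, pol, .inr m =>
      if hm : m < gs.length then
        if (gs[m]).fn = (if pol then GateFn.or (gs[m]).arity else GateFn.and (gs[m]).arity) then
          swForm.node (((List.ofFn (gs[m]).args).dedup).map fun w => swUnfold gs ℓ (!pol) w)
        else swForm.node [swUnfold gs ℓ (!pol) (.inr m)]
      else swForm.node []

/-- Unfolding an input slot at level `0`: the leaf `{e}`. [folklore] -/
theorem swUnfold_zero_inl (gs : List (Gate (⊤ : SimpleGraph (Fin n)).edgeSet)) (pol : Bool)
    (e : (⊤ : SimpleGraph (Fin n)).edgeSet) : swUnfold gs 0 pol (.inl e) = swForm.leaf {e} := by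
  cases pol <;> rfl

/-- Unfolding a gate wire at level `0` (junk): the empty leaf. [folklore] -/
theorem swUnfold_zero_inr (gs : List (Gate (⊤ : SimpleGraph (Fin n)).edgeSet)) (pol : Bool) (m : ℕ) :
    swUnfold gs 0 pol (.inr m) = swForm.leaf ∅ := by
  cases pol <;> rfl

/-- Unfolding an input slot at level `ℓ + 1`: a one-child node. [folklore] -/
theorem swUnfold_succ_inl (gs : List (Gate (⊤ : SimpleGraph (Fin n)).edgeSet)) (ℓ : ℕ) (pol : Bool)
    (e : (⊤ : SimpleGraph (Fin n)).edgeSet) :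
    swUnfold gs (ℓ + 1) pol (.inl e) = swForm.node [swUnfold gs ℓ (!pol) (.inl e)] := rfl

open Classical in
/-- Unfolding a gate wire at level `ℓ + 1`. [folklore] -/
theorem swUnfold_succ_inr (gs : List (Gate (⊤ : SimpleGraph (Fin n)).edgeSet)) (ℓ : ℕ) (pol : Bool) (m : ℕ) :
    swUnfold gs (ℓ + 1) pol (.inr m) =
      if hm : m < gs.length then
        if (gs[m]).fn = (if pol then GateFn.or (gs[m]).arity else GateFn.and (gs[m]).arity) then
          swForm.node (((List.ofFn (gs[m]).args).dedup).map fun w => swUnfold gs ℓ (!pol) w)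
        else swForm.node [swUnfold gs ℓ (!pol) (.inr m)]
      else swForm.node [] := rfl

/-- Registered stub `stub_formCircuitDefs` of the AC⁰ line, stage C (the junk case is an empty gate). [folklore] -/
theorem stub_formCircuitDefs : ∀ (n m : ℕ) (pol : Bool), @swUnfold n [] (0 + 1) pol (Sum.inr m) = swForm.node [] := by
  intro n m pol
  rw [swUnfold_succ_inr, dif_neg (by simp)]

end Summit.PneNP.PneNP.Theorems
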